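import Literature.NumberTheory.Rogawski1990.ExplicitFactorGlobalReciprocity
import Literature.NumberTheory.Rogawski1990.ExplicitFactorAlmostEverywhereTrivialTauWeyl
import Literature.NumberTheory.Rogawski1990.ArchExplicitTransferFactorNondegenerate
import Literature.NumberTheory.Automorphic.QuadraticLocalNormResidueBridge
import Literature.NumberTheory.Automorphic.QuadraticHeckeCharacterCM
import HarnessLib

/-!
# The product formula for Rogawski's explicit transfer factors, PART 1 (the three parts in global currency): the `τ`-quotient law,
# the `D_{G∕H}` square-root law, and the archimedean `κ` read as the sign of `σ_w(x_{j₀})` ∕ as the Hilbert symbol `(x, θ)_{w|L⁺}`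

Topic `NumberTheory/Rogawski1990`; namespace `Literature.NumberTheory.Rogawski1990`.  THEOREMS ONLY (no definition, no named fact, no instance, no notation,
no `sorry`; net debt 0).  PART 1 of 2 (this file: §1–§3, independent of the rational-pair localisation ★ `ExplicitFactorRationalLocalisation`; PART 2 =
`ExplicitFactorProductFormula.lean`: §4–§5, the assembly).  Cell `pub/hodgecm-mathlib`, F0∕P3a, topic T6, node **N4** of `F0/P3a/T6b-TREE.md` §9 (F4)
(desk TABLE #3 row (5)): the product-formula clause of the #72 letter ★ `GlobalTransferWithCartanKappaFormula` AT PRINT'S EXPLICIT COLLECTION (★ N1f `finExplicitCollection`, p827456; ★ `archCanonicalDelta`,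
p827252) is a THEOREM.  Print: «By a global property of transfer factors (cf. §4.9), `Π_v Δ′_v(γ, i(γ)) = 1`», «`Π_v Δ_v(γ, γ) = 1`» [Rogawski1990 §14.6 p. 242];
«the product formula `ΠΔ_{G_v∕H_v}(γ_{0v}) = 1` for `γ_0 ∈ M`» [§4.3 (4.3.3) p. 44]; [LanglandsShelstad1987 §6.4].

THE PROOF.  On a rational pair `(γ_H, γ)`, `γ_H = (g, u) ∈ H(L⁺)` `G`-regular, `γ ∈ U(H′)(L⁺)` with `ι(γ_H) ↔ γ` (★ `IsNormPair`; localised at every place by ★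
`isLocalNormPair_rationalComponent_toLocal_toAdelic`, ★ `isArchNormPair_rationalArch_cmRationalToArch`), each explicit factor is `τ · D_{G∕H} · κ` (★
`finExplicitDelta_of_isLocalNormPair`, ★ `archCanonicalDelta_of_isArchNormPair`) and every local ingredient is the image of a GLOBAL element (★ (R)
`ExplicitFactorRationalLocalisation`, p827972): `u`, `a = −χ_g(u)∕det g`, `k = χ_g(u)` in `Lˣ` (★ `gammaTwo_ne_zero`, ★ `eval_charpoly_gammaTwo_ne_zero_of_isGRegular`, `tauArg_ne_zero`, from
`G`-regularity at `∞`, ★ `ArchExplicitTransferFactorRegular`), and the relative position.  The three factors then die separately: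
* §1∕§5 `τ`: `μ_∞(u)μ_∞(a)⁻¹ · ∏_v μ_v(u)μ_v(a)⁻¹ = 1` — a Hecke character is trivial on principal idèles (★ `archHeckeValue_mul_finprod_semilocalComponent_eq_one`,
  p827658; here `archHeckeValue_div_mul_finprod_finHeckeValue_div_eq_one`, `finprod_finTau_mul_archTau_eq_one`);
* §2∕§5 `D_{G∕H}`: `(∏_w ‖σ_w k‖) · ∏_v √(∏_{w∣v} ‖k‖_w) = 1` — Artin–Whaples (★ `prod_norm_evalC_mul_finprod_sqrt_prod_placesOver_norm_eq_one`; here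
  `prod_norm_embedding_mul_finprod_sqrt_eq_one`, `finprod_finWeylRatio_mul_archWeylRatio_eq_one`);
* §3∕§4∕§5 `κ`: ALL the `κ`'s are Hilbert symbols of ONE `x ∈ (L⁺)ˣ` (`exists_kappa_eq_hilbertSymbol`): `x = p_{j₀}ᴴ H′ p_{j₀}` for the first non-zero column `p_{j₀}`
  of the global projector `P = χ_g(γ) ≠ 0` (`globalProjector_ne_zero`), which is `c`-fixed (`complexConj_columnFormValue`, `H′` hermitian); at a finite `v`,
  ★ `finKappaAt_rationalComponent` + the local bridge ★ `UnitaryGroup.ite_normTest_algebraMap_eq_hilbertSymbol` (p827951) give `κ_v = (x, θ)_v`; at a complex `w`,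
  `P_w = σ_w(P) = v qᵀ` (★ `archEigenlineProjector_eq_vecMulVec_of_conj_eq`), `tr(P_wᴴ H P_w) = ‖q‖² vᴴHv`, `σ_w(x) = |q_{j₀}|² vᴴHv` with `q_{j₀} ≠ 0` and
  `vᴴHv ∈ ℝˣ` (★ `star_dotProduct_form_mulVec_ne_zero_of_conj_eq`), so `κ‴_w = sgn Re σ_w(x) = (x, θ)_{w|L⁺}` (`archKappaSignAt_eq_sign_re_embedding_columnFormValue`,
  `hilbertSymbol_equivInfinitePlace_eq_sign`; `θ` = ★ `cmQuadraticGenerator`, totally negative); and `(∏_v (x, θ)_v) · ∏_{w′} (x, θ)_{w′} = 1` is Hilbert reciprocity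
  (★ `finprod_hilbertSymbol_mul_prod_infinitePlace_hilbertSymbol_eq_one`, from ★ `hilbertReciprocity_holds`), the complex places of `L` being the infinite places of
  `L⁺` (Mathlib `IsCMField.equivInfinitePlace`) — `finprod_finKappaAt_mul_prod_archKappaSignAt_eq_one`.
* §5 **`satisfiesProductFormula_finExplicitCollection`**: the three finitely supported products split (`finprod_mul_distrib`; supports from the a.e. riders of
  p827658) and regroup.
Hypotheses: `hherm : (H′.map c)ᵀ = H′`, `hanis` (anisotropy of `H′` on `L³`) — the T1 head's own binders; `μ` ANY Hecke character of `L`; `hl hr` the invariance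
families of ★ `finExplicitCollection` (★ p827517, ★ p827808 discharge them).
HONEST LABEL: HC_CM is proved only modulo the printed citations (named inputs remaining 2) until rung 0 closes; this file discharges the product-formula CLAUSE of #72
at the explicit collection and nothing else (the local transfer N6 and unit fundamental lemma N7 remain print's citations).

## References
* [Rogawski1990] J. D. Rogawski, *Automorphic Representations of Unitary Groups in Three Variables*, Ann. of Math. Stud. 123 (1990), §4.3 (4.3.3) p. 44, §4.9 p. 55,
  §14.6 p. 242; §3.5 Prop. 3.5.2 (c) p. 29.
* [LanglandsShelstad1987] R. P. Langlands, D. Shelstad, *On the definition of transfer factors*, Math. Ann. 278 (1987), §6.3–§6.4 (global hypothesis, product formula).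
* [Omeara1963] O. T. O'Meara, *Introduction to Quadratic Forms* (1963), §63B, §71 Thm. 71:18.
* [NeukirchANT1999] J. Neukirch, *Algebraic Number Theory* (1999), Ch. VII §6 (6.13).
* [CasselsFrohlichANT1967] J. W. S. Cassels, A. Fröhlich (eds.), *Algebraic Number Theory* (1967), Ch. II §12 (product formula).
-/
set_option autoImplicit false

noncomputable section

open NumberField NumberField.InfinitePlace NumberField.mixedEmbedding IsDedekindDomain Filter Matrix
open Literature.NumberTheory.GaloisRepresentations
open Literature.AlgebraicGeometry.ShimuraVarieties (hermForm)
open scoped Classical ComplexOrder MatrixGroups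

namespace Literature.NumberTheory.Rogawski1990

open Literature.NumberTheory.Automorphic

variable (L : Type) [Field L] [NumberField L]

/-! ## §1 The `τ`-part: `μ`-values of a global unit over all places -/

/-- **`μ_∞(k ⊗ 1) · ∏_v μ_v(k ⊗ 1) = 1`** for a global `k ∈ Lˣ`, in the currency of ★ `archHeckeValue` (N1a) and ★ `finHeckeValue` (N1f)
(★ `archHeckeValue_mul_finprod_semilocalComponent_eq_one`). [cite: Rogawski1990, §14.6 p. 242] [cite: NeukirchANT1999, Ch. VII §6 Prop. (6.13) (proof)] -/
theorem archHeckeValue_mul_finprod_finHeckeValue_eq_one (μ : HeckeCharacter L) (k : Lˣ) :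
    archHeckeValue L μ (mixedEmbedding L (k : L)) *
      ∏ᶠ v : HeightOneSpectrum (𝓞 ↥(maximalRealSubfield L)), finHeckeValue L v μ (algebraMap L (UnitaryGroup.LocalRing L v) (k : L)) = 1 := by
  rw [finprod_congr fun v => finHeckeValue_algebraMap_units L μ v k]
  exact archHeckeValue_mul_finprod_semilocalComponent_eq_one (↥(maximalRealSubfield L)) μ k

/-- `μ_v(k ⊗ 1) = 1` for almost all `v` (`k ∈ Lˣ`), ★ `finHeckeValue` currency. [cite: Rogawski1990, §14.6 p. 242] [cite: TateThesis1967, §4.3] -/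
theorem finite_mulSupport_finHeckeValue_algebraMap (μ : HeckeCharacter L) (k : Lˣ) :
    (Function.mulSupport fun v : HeightOneSpectrum (𝓞 ↥(maximalRealSubfield L)) =>
      finHeckeValue L v μ (algebraMap L (UnitaryGroup.LocalRing L v) (k : L))).Finite := by
  refine (eventually_cofinite.1 (eventually_semilocalComponent_map_algebraMap_eq_one (↥(maximalRealSubfield L)) μ k)).subset
    fun v hv => ?_
  intro hv1
  refine hv ?_
  change finHeckeValue L v μ (algebraMap L (UnitaryGroup.LocalRing L v) (k : L)) = 1
  rw [finHeckeValue_algebraMap_units, hv1, Units.val_one]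

/-- **THE `τ`-PART OF THE PRODUCT FORMULA**: for global `u, a ∈ Lˣ`,
`[μ_∞(u) · μ_∞(a)⁻¹] · ∏_v [μ_v(u) · μ_v(a)⁻¹] = 1` — with `u = γ₂`, `a = −χ_g(γ₂)∕det g` this is `τ_∞(γ_H) · ∏_v τ_v(γ_H) = 1` for a rational
`γ_H` (★ `archTau`, ★ `finTau`). [cite: Rogawski1990, §4.9 p. 55; §14.6 p. 242] -/
theorem archHeckeValue_div_mul_finprod_finHeckeValue_div_eq_one (μ : HeckeCharacter L) (u a : Lˣ) :
    archHeckeValue L μ (mixedEmbedding L (u : L)) * (archHeckeValue L μ (mixedEmbedding L (a : L)))⁻¹ *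
      ∏ᶠ v : HeightOneSpectrum (𝓞 ↥(maximalRealSubfield L)),
        (finHeckeValue L v μ (algebraMap L (UnitaryGroup.LocalRing L v) (u : L)) *
          (finHeckeValue L v μ (algebraMap L (UnitaryGroup.LocalRing L v) (a : L)))⁻¹) = 1 := by
  have hu := archHeckeValue_mul_finprod_finHeckeValue_eq_one L μ u
  have ha := archHeckeValue_mul_finprod_finHeckeValue_eq_one L μ a
  have hg : (Function.mulSupport fun v : HeightOneSpectrum (𝓞 ↥(maximalRealSubfield L)) =>
      (finHeckeValue L v μ (algebraMap L (UnitaryGroup.LocalRing L v) (a : L)))⁻¹).Finite :=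
    (finite_mulSupport_finHeckeValue_algebraMap L μ a).subset fun v hv h1 =>
      hv (show (finHeckeValue L v μ (algebraMap L (UnitaryGroup.LocalRing L v) (a : L)))⁻¹ = 1 by
        change finHeckeValue L v μ (algebraMap L (UnitaryGroup.LocalRing L v) (a : L)) = 1 at h1
        rw [h1, inv_one])
  rw [finprod_mul_distrib (finite_mulSupport_finHeckeValue_algebraMap L μ u) hg,
    finprod_inv_distrib]
  calc archHeckeValue L μ (mixedEmbedding L (u : L)) * (archHeckeValue L μ (mixedEmbedding L (a : L)))⁻¹ *
        ((∏ᶠ v : HeightOneSpectrum (𝓞 ↥(maximalRealSubfield L)), finHeckeValue L v μ (algebraMap L (UnitaryGroup.LocalRing L v) (u : L))) *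
          (∏ᶠ v : HeightOneSpectrum (𝓞 ↥(maximalRealSubfield L)), finHeckeValue L v μ (algebraMap L (UnitaryGroup.LocalRing L v) (a : L)))⁻¹)
      = (archHeckeValue L μ (mixedEmbedding L (u : L)) *
            ∏ᶠ v : HeightOneSpectrum (𝓞 ↥(maximalRealSubfield L)), finHeckeValue L v μ (algebraMap L (UnitaryGroup.LocalRing L v) (u : L))) *
          (archHeckeValue L μ (mixedEmbedding L (a : L)) *
            ∏ᶠ v : HeightOneSpectrum (𝓞 ↥(maximalRealSubfield L)), finHeckeValue L v μ (algebraMap L (UnitaryGroup.LocalRing L v) (a : L)))⁻¹ := by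
        rw [mul_inv]; ring
    _ = 1 := by rw [hu, ha, inv_one, mul_one]

/-! ## §2 The `D`-part: normalised absolute values of a global element over all places -/

/-- **THE `D`-PART OF THE PRODUCT FORMULA** (`L` CM, hence totally complex): for `k ∈ Lˣ`,
`(∏_{w complex} ‖σ_w(k)‖) · ∏_v √(∏_{w∣v} ‖k‖_w) = 1` — with `k = χ_g(γ₂)` this is `D_{G∕H,∞}(γ_H) · ∏_v D_{G∕H,v}(γ_H) = 1` for a rational `γ_H` in the
currency of ★ `archWeylRatio` ∕ ★ `finWeylRatio` (★ `prod_norm_evalC_mul_finprod_sqrt_prod_placesOver_norm_eq_one`, `w.1.embedding` spelling).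
[cite: Rogawski1990, §4.9 p. 55; §14.6 p. 242] [cite: CasselsFrohlichANT1967, Ch. II §12] -/
theorem prod_norm_embedding_mul_finprod_sqrt_eq_one [IsTotallyComplex L] {k : L} (hk : k ≠ 0) :
    (∏ w : {w : InfinitePlace L // IsComplex w}, ‖w.1.embedding k‖) *
      ∏ᶠ v : HeightOneSpectrum (𝓞 ↥(maximalRealSubfield L)),
        Real.sqrt (∏ w : UnitaryGroup.PlacesOver L v, ‖algebraMap L (w.1.adicCompletion L) k‖) = 1 := by
  have h := prod_norm_evalC_mul_finprod_sqrt_prod_placesOver_norm_eq_one (↥(maximalRealSubfield L)) (E := L) hk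
  have h1 : (∏ w : {w : InfinitePlace L // IsComplex w}, ‖w.1.embedding k‖) =
      ∏ w : {w : InfinitePlace L // IsComplex w}, ‖UnitaryGroup.evalC L w (mixedEmbedding L k)‖ :=
    Finset.prod_congr rfl fun w _ => by rw [UnitaryGroup.evalC_apply, mixedEmbedding_apply_isComplex]
  have h2 : (fun v : HeightOneSpectrum (𝓞 ↥(maximalRealSubfield L)) =>
        Real.sqrt (∏ w : UnitaryGroup.PlacesOver L v, ‖algebraMap L (w.1.adicCompletion L) k‖)) =
      fun v => Real.sqrt (∏ w : UnitaryGroup.PlacesOver L v, ‖(k : w.1.adicCompletion L)‖) := by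
    funext v
    exact congrArg Real.sqrt (Finset.prod_congr rfl fun w _ => by rw [algebraMap_adicCompletion_apply])
  rw [h1, h2]
  exact h

/-! ## §3 The `κ`-part: matrix algebra over `ℂ` and over `L` (independent of the localisation lemmas) -/

section KappaAlgebra

variable {n : Type*} [Fintype n]

/-- `Σ_i |r_i|²` as the complex number `r̄ · r`. [folklore] -/
private theorem star_dotProduct_self_eq_ofReal (r : n → ℂ) :
    star r ⬝ᵥ r = ((∑ i, Complex.normSq (r i) : ℝ) : ℂ) := by
  rw [Complex.ofReal_sum]
  simp only [dotProduct, Pi.star_apply, Complex.star_def, Complex.normSq_eq_conj_mul_self]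

/-- `Σ |r_i|² = 0 ↔ r = 0`. [folklore] -/
private theorem sum_normSq_eq_zero_iff (r : n → ℂ) : (∑ i, Complex.normSq (r i)) = 0 ↔ r = 0 := by
  rw [← Complex.ofReal_eq_zero, ← star_dotProduct_self_eq_ofReal, dotProduct_star_self_eq_zero]

/-- Trace of a rank-one hermitian congruence: `tr((p qᵀ)ᴴ H (p qᵀ)) = (q̄·q)(p̄ᵀ H p)`. [folklore] -/
private theorem trace_conjTranspose_vecMulVec_mul_mul (p q : n → ℂ) (H : Matrix n n ℂ) :
    ((vecMulVec p q)ᴴ * H * vecMulVec p q).trace = (star q ⬝ᵥ q) * (star p ⬝ᵥ H *ᵥ p) := by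
  rw [conjTranspose_vecMulVec, vecMulVec_mul, vecMulVec_mul_vecMulVec, trace_vecMulVec, dotProduct_smul, ← dotProduct_mulVec,
    smul_eq_mul, mul_comm]

/-- The `H`-value of the `j`-th column of a rank-one matrix: `(p q_j)ᴴ H (p q_j) = |q_j|² (p̄ᵀ H p)`. [folklore] -/
private theorem star_col_vecMulVec_dotProduct_mulVec (p q : n → ℂ) (H : Matrix n n ℂ) (j : n) :
    star (fun i => vecMulVec p q i j) ⬝ᵥ H *ᵥ (fun i => vecMulVec p q i j) =
      ((Complex.normSq (q j) : ℝ) : ℂ) * (star p ⬝ᵥ H *ᵥ p) := by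
  have hcol : (fun i => vecMulVec p q i j) = q j • p := by
    funext i
    simp only [vecMulVec_apply, Pi.smul_apply, smul_eq_mul, mul_comm]
  rw [hcol, star_smul, mulVec_smul, dotProduct_smul, smul_dotProduct, smul_smul, smul_eq_mul, Complex.star_def,
    Complex.normSq_eq_conj_mul_self, mul_comm (q j)]

/-- `sign (r · z).re = sign z.re` for a real `r > 0`. [folklore] -/
private theorem sign_re_ofReal_mul {r : ℝ} (hr : 0 < r) (z : ℂ) :
    SignType.sign (((r : ℂ) * z).re) = SignType.sign z.re := by
  rw [Complex.re_ofReal_mul, sign_mul, sign_pos hr, one_mul]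

end KappaAlgebra

section KappaGlobal

variable [IsCMField L] (H' : Matrix (Fin 3) (Fin 3) L)

/-- **The column form values are `c`-fixed**: for a `c`-hermitian `H′` (`(H′.map c)ᵀ = H′`) and any `P ∈ M₃(L)`, `x_j = Σ_{i,k} c(P_{ij}) H′_{ik} P_{kj}`
satisfies `c(x_j) = x_j` — so the relative position of ★ `finRelPos` ∕ (R) lies in `L⁺`. [cite: Rogawski1990, §3.5 Prop. 3.5.2 (c) p. 29] -/
theorem complexConj_columnFormValue (hherm : (H'.map (cmConjRingHom L)).transpose = H') (P : Matrix (Fin 3) (Fin 3) L) (j : Fin 3) :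
    IsCMField.complexConj L (∑ i : Fin 3, ∑ k : Fin 3, IsCMField.complexConj L (P i j) * H' i k * P k j) =
      ∑ i : Fin 3, ∑ k : Fin 3, IsCMField.complexConj L (P i j) * H' i k * P k j := by
  have hH : ∀ i k, IsCMField.complexConj L (H' i k) = H' k i := fun i k => by
    have h := congrFun (congrFun hherm k) i
    rw [Matrix.transpose_apply, Matrix.map_apply] at h
    exact h
  simp only [map_sum, map_mul, IsCMField.complexConj_apply_apply, hH]
  rw [Finset.sum_comm]
  exact Finset.sum_congr rfl fun i _ => Finset.sum_congr rfl fun k _ => by ring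

/-- **`σ_w(x_j) = (P_w e_j)ᴴ · w(H′) · (P_w e_j)`** for `P_w = P.map σ_w`: a complex embedding turns the `c`-sesquilinear column value into the hermitian one
(`σ_w ∘ c = conj ∘ σ_w` on a CM field, Mathlib `IsCMField.complexEmbedding_complexConj`). [cite: Rogawski1990, §14.6 p. 242] -/
theorem embedding_columnFormValue (w : {w : InfinitePlace L // IsComplex w}) (P : Matrix (Fin 3) (Fin 3) L) (j : Fin 3) :
    w.1.embedding (∑ i : Fin 3, ∑ k : Fin 3, IsCMField.complexConj L (P i j) * H' i k * P k j) =
      star (fun i => (P.map w.1.embedding) i j) ⬝ᵥ (H'.map w.1.embedding) *ᵥ (fun i => (P.map w.1.embedding) i j) := by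
  simp only [map_sum, map_mul, IsCMField.complexEmbedding_complexConj, dotProduct, mulVec, Matrix.map_apply, Pi.star_apply,
    Complex.star_def, Finset.mul_sum]
  exact Finset.sum_congr rfl fun i _ => Finset.sum_congr rfl fun k _ => by ring

end KappaGlobal

section KappaArch

variable [IsCMField L] (H' : Matrix (Fin 3) (Fin 3) L)
  (a : ↥(UnitaryGroup.arch (↥(maximalRealSubfield L)) L (IsCMField.complexConj L) 2
      (Matrix.of fun i j : Fin 2 => if i.val + j.val + 1 = 2 then (1 : L) else 0)) ×
    ↥(UnitaryGroup.arch (↥(maximalRealSubfield L)) L (IsCMField.complexConj L) 1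
      (Matrix.of fun i j : Fin 1 => if i.val + j.val + 1 = 1 then (1 : L) else 0)))
  (b : ↥(UnitaryGroup.arch (↥(maximalRealSubfield L)) L (IsCMField.complexConj L) 3 H'))
  (w : {w : InfinitePlace L // IsComplex w})

/-- **`κ‴_w` READS THE SIGN OF `σ_w(x_{j₀})`**: on a `G`-regular matching archimedean pair whose projector `P_w` is the `σ_w`-image of a matrix `P ∈ M₃(L)`
(the RATIONAL case, ★ `archEigenlineProjector_rationalArch`), for any column `j₀` of `P` that is not zero, ★ `archKappaSignAt` — `sgn Re tr(P_wᴴ w(H′) P_w)` — equals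
`sgn Re σ_w(x_{j₀})`, `x_{j₀} = Σ c(P_{i j₀}) H′_{ik} P_{k j₀}`: `P_w = v qᵀ` has rank one (★ `archEigenlineProjector_eq_vecMulVec_of_conj_eq`), so
`tr(P_wᴴ H P_w) = ‖q‖² · vᴴHv` and `σ_w(x_{j₀}) = |q_{j₀}|² · vᴴHv` with `q_{j₀} ≠ 0` and `vᴴHv ∈ ℝˣ` (★ `star_dotProduct_form_mulVec_ne_zero_of_conj_eq`).
[cite: Rogawski1990, §14.6 p. 242; §3.5 Prop. 3.5.2 (c) p. 29] [cite: LanglandsShelstad1987, §2] -/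
theorem archKappaSignAt_eq_sign_re_embedding_columnFormValue (hherm : (H'.map (cmConjRingHom L)).transpose = H')
    (hanis : ∀ x : Fin 3 → L, hermForm (cmConjRingHom L) H' x x = 0 → x = 0) (hp : IsArchNormPair L H' a b) (hreg : IsArchGRegular L a)
    {P : Matrix (Fin 3) (Fin 3) L} (hP : archEigenlineProjector L H' a w b = P.map w.1.embedding) {j₀ : Fin 3} (hj₀ : ∃ i, P i j₀ ≠ 0) :
    archKappaSignAt L H' a w b =
      (SignType.sign ((w.1.embedding (∑ i : Fin 3, ∑ k : Fin 3, IsCMField.complexConj L (P i j₀) * H' i k * P k j₀)).re) : ℤ) := by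
  have hp' := hp
  rw [isArchNormPair_iff] at hp'
  obtain ⟨c, hc⟩ := isConj_iff.1 hp'
  set φ := UnitaryGroup.evalC L w with hφ
  set H := H'.map w.1.embedding with hH
  set v : Fin 3 → ℂ := fun i => φ ((c : Matrix (Fin 3) (Fin 3) (mixedEmbedding.mixedSpace L)) i 1) with hv
  set s : ℂ := φ ((archCharpolyTwo L a).eval (archGammaTwo L a)) with hsdef
  set q : Fin 3 → ℂ := fun j => s * φ (((c⁻¹ : GL (Fin 3) (mixedEmbedding.mixedSpace L)) : Matrix (Fin 3) (Fin 3) (mixedEmbedding.mixedSpace L)) 1 j)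
    with hq
  have hPvq : archEigenlineProjector L H' a w b = vecMulVec v q := archEigenlineProjector_eq_vecMulVec_of_conj_eq L H' a b w c hc
  have hPw : P.map w.1.embedding = vecMulVec v q := hP.symm.trans hPvq
  -- `z = vᴴ H v` is real and non-zero
  have hz : star v ⬝ᵥ H *ᵥ v ≠ 0 := star_dotProduct_form_mulVec_ne_zero_of_conj_eq L H' a b w hanis hreg c hc
  have hHh : Hᴴ = H := by
    have hcomp : (star : ℂ → ℂ) ∘ (w.1.embedding : L → ℂ) = (w.1.embedding : L → ℂ) ∘ (cmConjRingHom L : L → L) := by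
      funext x
      simp only [Function.comp_apply, embedding_cmConjRingHom, Complex.star_def]
    rw [hH, Matrix.conjTranspose, Matrix.transpose_map, Matrix.map_map, hcomp, ← Matrix.map_map, ← Matrix.transpose_map, hherm]
  have hzz : star (star v ⬝ᵥ H *ᵥ v) = star v ⬝ᵥ H *ᵥ v := by
    rw [← Matrix.star_dotProduct_star, star_star, Matrix.star_mulVec, hHh, ← Matrix.dotProduct_mulVec]
  have hzre : ((star v ⬝ᵥ H *ᵥ v).re : ℂ) = star v ⬝ᵥ H *ᵥ v := Complex.conj_eq_iff_re.1 (by rw [← Complex.star_def]; exact hzz)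
  -- `q_{j₀} ≠ 0`: column `j₀` of `P_w = v qᵀ` is `q_{j₀} • v`, and it is non-zero because column `j₀` of `P` is
  have hq0 : q j₀ ≠ 0 := by
    obtain ⟨i, hi⟩ := hj₀
    have h1 : (P.map w.1.embedding) i j₀ ≠ 0 := by
      rw [Matrix.map_apply]
      exact (map_ne_zero w.1.embedding).2 hi
    rw [hPw, vecMulVec_apply] at h1
    exact right_ne_zero_of_mul h1
  have hqq : q ≠ 0 := fun h => hq0 (by rw [h, Pi.zero_apply])
  have hQ : 0 < ∑ i, Complex.normSq (q i) :=
    lt_of_le_of_ne (Finset.sum_nonneg fun i _ => Complex.normSq_nonneg _) (fun h => hqq ((sum_normSq_eq_zero_iff q).1 h.symm))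
  have hQ0 : 0 < Complex.normSq (q j₀) := Complex.normSq_pos.2 hq0
  -- both sides are `sign (vᴴ H v).re`
  unfold archKappaSignAt
  rw [hPvq, trace_conjTranspose_vecMulVec_mul_mul, star_dotProduct_self_eq_ofReal, sign_re_ofReal_mul hQ,
    embedding_columnFormValue L H' w P j₀, hPw, star_col_vecMulVec_dotProduct_mulVec, sign_re_ofReal_mul hQ0]

end KappaArch

section RealPlaces

variable [IsCMField L]

/-- **The real place under a complex place reads the real part**: for `x ∈ L⁺` and an infinite place `w` of the CM field `L`, the real embedding of `L⁺` at
`w|_{L⁺}` (Mathlib `IsCMField.equivInfinitePlace`) is `x ↦ σ_w(x)` (`comap_embedding_of_isReal`). [cite: Rogawski1990, §14.6 p. 242] -/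
theorem embedding_of_isReal_equivInfinitePlace_apply (w : InfinitePlace L) (x : ↥(maximalRealSubfield L)) :
    ((InfinitePlace.embedding_of_isReal (IsTotallyReal.isReal (IsCMField.equivInfinitePlace L w)) x : ℝ) : ℂ) =
      w.embedding (algebraMap ↥(maximalRealSubfield L) L x) := by
  rw [InfinitePlace.embedding_of_isReal_apply]
  have h := InfinitePlace.comap_embedding_of_isReal (algebraMap ↥(maximalRealSubfield L) L)
    (IsTotallyReal.isReal (IsCMField.equivInfinitePlace L w))
  rw [IsCMField.equivInfinitePlace_apply, h, RingHom.comp_apply]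

/-- The same, as a real part: `σ_{w|L⁺}(x) = Re σ_w(x)`. [cite: Rogawski1990, §14.6 p. 242] -/
theorem embedding_of_isReal_equivInfinitePlace_eq_re (w : InfinitePlace L) (x : ↥(maximalRealSubfield L)) :
    InfinitePlace.embedding_of_isReal (IsTotallyReal.isReal (IsCMField.equivInfinitePlace L w)) x =
      (w.embedding (algebraMap ↥(maximalRealSubfield L) L x)).re := by
  rw [← embedding_of_isReal_equivInfinitePlace_apply, Complex.ofReal_re]

/-- **`(x, θ)_{w|L⁺} = sgn Re σ_w(x)`** for `x ∈ (L⁺)ˣ` and the totally negative CM generator `θ` (★ `cmQuadraticGenerator`, ★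
`embedding_cmQuadraticGenerator_lt_zero'`), by ★ `UnitaryGroup.hilbertSymbol_completion_eq_sign_of_isReal`. [cite: Omeara1963, §63B] [cite: Rogawski1990, §14.6 p. 242] -/
theorem hilbertSymbol_equivInfinitePlace_eq_sign (w : InfinitePlace L) {x : ↥(maximalRealSubfield L)} (hx : x ≠ 0) :
    QuadraticForms.hilbertSymbol (IsCMField.equivInfinitePlace L w).Completion
        (algebraMap ↥(maximalRealSubfield L) _ x) (algebraMap ↥(maximalRealSubfield L) _ (cmQuadraticGenerator L : ↥(maximalRealSubfield L))) =
      (SignType.sign ((w.embedding (algebraMap ↥(maximalRealSubfield L) L x)).re) : ℤ) := by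
  rw [UnitaryGroup.hilbertSymbol_completion_eq_sign_of_isReal (IsTotallyReal.isReal (IsCMField.equivInfinitePlace L w)) hx
      (embedding_cmQuadraticGenerator_lt_zero' L _ _),
    embedding_of_isReal_equivInfinitePlace_eq_re]

end RealPlaces

end Literature.NumberTheory.Rogawski1990
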